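import Summits.HodgeConjecture.HodgeConjecture.Theorems.K2E1SphericalHeckeGoodTestFunctionU2   -- ★ p858749 P5b (+ ★ p858708 P5): `ĥ`, the double `K`-average, the tube
import Summits.HodgeConjecture.HodgeConjecture.Theorems.K2E1BLBorelSpacesU2Defs                -- ★ p858761 leaf of record (Z = B(F)∖G(𝔸)): `HX`, `HN`, `cnstN`
import Summits.HodgeConjecture.HodgeConjecture.Theorems.K2E1BLHeightCosetsU2                   -- ★ p858699 BL-R1: `exists_torus_posRealIdele_two` (the torus ray `d(z(r), z(r)⁻¹)`)
import HarnessLib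

/-!
# Bernstein–Lapid uniqueness for the spherical system on `U(J_N)(𝔸_F)`: the pair `(ψ, b)` solving
# (Ξ₁) `δ(h)ψ = ĥ(z)ψ` and (Ξ₂) `cnst_k(ιψ) = φ₀H^z + b·H^{1−z}` is unique on the open set `{‖δ(h)‖ < |ĥ(z)|}`,
# which is non-empty inside every right half-plane

(Bernstein–Lapid, *On the meromorphic continuation of Eisenstein series*, arXiv:1911.02342 = J. AMS 37 (2024), §2.3
Thm 2.3 (hypothesis «unique solution on a non-empty open set») and §4 Claims 1–2 (p. 9); Langlands LNM 544 §6.)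

Topic `NumberTheory/Automorphic`; crux H413, cell `pub/hodgecm-mathlib`, campaign «EIS-R7-BL-SPH-2», road card
`ROADCARD-BL-SPH-3` ∕ wiring (ζ′) §3, deal «BL-P6» (K2E1-plan (g5) 2026-09-04T08:55:11Z). THEOREMS ONLY over accepted tree
modules (no definition, no named fact, no instance, no notation, no `sorry`).

WHY THIS IS ENOUGH. ★ P1a `exists_meromorphic_solution` (Thm 2.3) asks for `hunq : ∃ U₀, IsOpen U₀ ∧ U₀.Nonempty ∧ U₀ ⊆ D ∧ ∀ s ∈ U₀,
∃! v, A s v = c s` — uniqueness on SOME non-empty open set. For the pair system in `(ψ, b) ∈ 𝓗_k(𝔛) × ℂ`: if `‖δ(h)‖ ≤ M < |ĥ(z)|`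
then `δ(h)d = ĥ(z)d` forces `d = 0` for `d = ψ − ψ′`, and `(b − b′)·H^{1−z} = 0` forces `b = b′` ((Ξ₃) unused — dually to B–L's
Claim 2, which does not use (Ξ₁)). `{z : M < |ĥ(z)|}` is open (`ĥ` entire, ★ P5) and meets every half-plane `{Re z > σ₁}` since
`ĥ(σ) → +∞` along the real axis once `h ≥ 0` charges `{H > 1}` (§3). HONEST REMARK: `|ĥ(σ + it)| → 0` as `|t| → ∞`, so this route
does NOT give uniqueness on a whole half-plane (B–L's Claim 2, K1-dependent, does; different file).

* §1 ABSTRACT (complex Banach spaces `V`, `W`): `eq_zero_of_map_eq_smul_of_opNorm_lt`, **`pair_unique`**, `existsUnique_pair_of_exists`,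
  `isOpen_setOf_lt_norm`.
* §2 THE E1 LETTERS (★ leaf of record p858761 `K2E1BLBorelSpacesU2Defs`, `Z = B(F)∖G(𝔸)`: `HX F E c N k μ`, `HN F E c N k c₁ μZ`, `cnstN`; letters `T` = «`δ(h)` on `𝓗_k(𝔛)`» with its bound
  `hT : ‖T‖ ≤ M` (P3), `ι` = «`ι_{c,k}`» (operator leaf), `α β : ℂ → HN` the constant-term data): **`bl_pair_unique`**,
  `isOpen_blUniqueSet`.
* §3 NON-EMPTINESS: `integral_mul_borelHeight_rpow_ge` (lower bound `(h(g₀)∕2)·q^σ·μ(O)`), **`tendsto_integral_mul_borelHeight_rpow_atTop`**,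
  `integral_ofReal_mul_cpow_ofReal` (`ĥ(σ) = ∫ h H^σ` for real `σ`), **`exists_gt_and_lt_norm_integral`** (`∀ σ₁ M, ∃ σ > σ₁, M < |ĥ(σ)|`),
  `blUniqueSet_nonempty`.
* §4 THE GOOD `h` WITH `h(1) > 0` (★ P5b's construction re-run to export `h(1) > 0`) and the closing corollary
  **`exists_testFunction_forall_exists_lt_norm`**: under «`1 ∈ closure {1 < H}`» (hypothesis `h1`, any `N`), for every `z₀` there is a
  continuous, compactly supported, non-negative, bi-`K_U`-invariant `h` with `ĥ(z₀) ≠ 0` AND `∀ σ₁ M, ∃ σ > σ₁, M < |ĥ(σ)|`.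
* §5 `N = 2` HYPOTHESIS-FREE: `one_mem_closure_setOf_one_lt_borelHeight_two` (the torus ray of ★ BL-R1, `H(t_s) = e^{s[E:ℚ]}`, `t_s → 1`,
  continuity ★ `DoubledUnitary.RankOneReduction.continuous_diag_posRealIdele_exp`),
  **`exists_testFunction_forall_exists_lt_norm_two`**, `…_cm_two`.

## References
* J. Bernstein, E. Lapid, *On the meromorphic continuation of Eisenstein series*, arXiv:1911.02342, J. AMS 37 (2024): §2.3 Thm 2.3, §4 Claims 1–2 [BernsteinLapid2019].
* R. P. Langlands, *On the Functional Equations Satisfied by Eisenstein Series*, LNM 544 (1976), §6 [Langlands1976].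
-/

set_option autoImplicit false
set_option linter.dupNamespace false

noncomputable section

open MeasureTheory Measure NumberField IsDedekindDomain Set Filter Matrix Metric Complex Topology
open scoped ENNReal NNReal MatrixGroups Pointwise
open Literature.NumberTheory Literature.NumberTheory.Automorphic Literature.NumberTheory.Automorphic.UnitaryGroup
open AdelicGroupData
open Summit.HodgeConjecture.HodgeConjecture.Cruxes.H413.K2E1SphericalHeckeEigenSectionU2
open Summit.HodgeConjecture.HodgeConjecture.Cruxes.H413.K2E1SphericalHeckeGoodTestFunctionU2
open Summit.HodgeConjecture.HodgeConjecture.Cruxes.H413.K2E1BLBorelSpacesU2Defs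
open Summit.HodgeConjecture.HodgeConjecture.Cruxes.H413.K2E1HeightFunctionU3 (borelHeight_one)
open Summit.HodgeConjecture.HodgeConjecture.Cruxes.H413.K2E1BLHeightCosetsU2 (exists_torus_posRealIdele_two)

namespace Summit.HodgeConjecture.HodgeConjecture.Cruxes.H413.K2E1BLUniquenessU2

/-! ## §1 The abstract operator-norm uniqueness -/

section Abstract

variable {V W : Type*} [NormedAddCommGroup V] [NormedSpace ℂ V] [NormedAddCommGroup W] [NormedSpace ℂ W]

/-- If `T d = λ•d` with `‖T‖ < |λ|` then `d = 0` (`|λ|‖d‖ = ‖Td‖ ≤ ‖T‖‖d‖`). [cite: BernsteinLapid2019, §4 Claim 1] -/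
theorem eq_zero_of_map_eq_smul_of_opNorm_lt (T : V →L[ℂ] V) {lam : ℂ} (hlam : ‖T‖ < ‖lam‖) {d : V} (hd : T d = lam • d) : d = 0 := by
  by_contra hne
  have hpos : 0 < ‖d‖ := norm_pos_iff.2 hne
  have h := T.le_opNorm d
  rw [hd, norm_smul] at h
  exact absurd (le_of_mul_le_mul_right h hpos) (not_le.2 hlam)

/-- **Uniqueness of the pair.** Let `T : V →L V`, `Λ : V →L W`, `α β ∈ W` with `β ≠ 0`, and `λ` with `‖T‖ < |λ|`. If `(ψ, b)` and
`(ψ′, b′)` both solve (Ξ₁) `Tψ = λψ` and (Ξ₂) `Λψ = α + b•β`, then `ψ = ψ′` and `b = b′`. [cite: BernsteinLapid2019, §4 Claim 2] -/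
theorem pair_unique (T : V →L[ℂ] V) (Λ : V →L[ℂ] W) {α β : W} (hβ : β ≠ 0) {lam : ℂ} (hlam : ‖T‖ < ‖lam‖)
    {ψ ψ' : V} {b b' : ℂ} (h₁ : T ψ = lam • ψ) (h₂ : Λ ψ = α + b • β) (h₁' : T ψ' = lam • ψ') (h₂' : Λ ψ' = α + b' • β) : ψ = ψ' ∧ b = b' := by
  have hψ : ψ = ψ' := sub_eq_zero.1 (eq_zero_of_map_eq_smul_of_opNorm_lt T hlam (by rw [map_sub, h₁, h₁', smul_sub]))
  refine ⟨hψ, ?_⟩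
  rw [hψ] at h₂
  have hb : (b - b') • β = 0 := by rw [sub_smul, sub_eq_zero]; exact (h₂.symm.trans h₂') |> fun h => add_left_cancel h
  exact sub_eq_zero.1 ((smul_eq_zero.1 hb).resolve_right hβ)

/-- `∃ ⇒ ∃!` for the pair system (the shape ★ P1a's `hunq` consumes, for any encoding of the pair as one unknown).
[cite: BernsteinLapid2019, Thm 2.3] -/
theorem existsUnique_pair_of_exists (T : V →L[ℂ] V) (Λ : V →L[ℂ] W) {α β : W} (hβ : β ≠ 0) {lam : ℂ}
    (hlam : ‖T‖ < ‖lam‖) (hex : ∃ p : V × ℂ, T p.1 = lam • p.1 ∧ Λ p.1 = α + p.2 • β) : ∃! p : V × ℂ, T p.1 = lam • p.1 ∧ Λ p.1 = α + p.2 • β := by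
  refine existsUnique_of_exists_of_unique hex fun p q hp hq => ?_
  obtain ⟨h1, h2⟩ := pair_unique T Λ hβ hlam hp.1 hp.2 hq.1 hq.2
  exact Prod.ext h1 h2

/-- The uniqueness set `{z ∈ D : M < |ĥ(z)|}` is open for `ĥ` continuous and `D` open. [cite: BernsteinLapid2019, Thm 2.3] -/
theorem isOpen_setOf_lt_norm {hhat : ℂ → ℂ} (hc : Continuous hhat) {D : Set ℂ} (hD : IsOpen D) (M : ℝ) : IsOpen {z | z ∈ D ∧ M < ‖hhat z‖} :=
  hD.inter (isOpen_lt continuous_const hc.norm)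

end Abstract

/-! ## §2 The E1 letters: `V = 𝓗_k(𝔛)`, `W = 𝓗_k(Z_c)`, `Λ = cnst_k ∘ ι`, `λ = ĥ(z)` -/

section E1

variable {F E : Type} [Field F] [NumberField F] [Field E] [NumberField E] [Algebra F E] {c : E ≃ₐ[F] E}
variable {N : ℕ} [NeZero N]
variable [MeasurableSpace (quasiSplit F E c N).Adelic] [BorelSpace (quasiSplit F E c N).Adelic]

omit [BorelSpace (quasiSplit F E c N).Adelic] in
/-- **(BL-P6) Uniqueness of the pair `(ψ, b)` in Bernstein–Lapid's spaces.** Letters: `ĥ(z) = ∫ h(x) H(x)^z dμG` (★ P5); `𝓗_k(𝔛) = HX F E c N k μ`,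
`𝓗_k(Z_c) = HN F E c N k c₁ μZ` on `Z = B(F)∖G(𝔸)` with its constant-term projection `cnstN` (★ leaf of record); `T` = `δ(h)` on `𝓗_k(𝔛)` with
`‖T‖ ≤ M` (P3), `ι` = `ι_{c,k}`, `α z`, `β z ∈ 𝓗_k(Z_c)` the constant-term data (`φ₀H^z`, `H^{1−z}`), `β z ≠ 0`. If `M < |ĥ(z)|`, two pairs solving
(Ξ₁) `Tψ = ĥ(z)ψ` and (Ξ₂) `cnst_k(ιψ) = α z + b•β z` are equal. [cite: BernsteinLapid2019, §4 Claim 2] -/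
theorem bl_pair_unique (μG : Measure (quasiSplit F E c N).Adelic) (h : (quasiSplit F E c N).Adelic → ℂ)
    {k : ℕ} {μ : Measure (quasiSplit F E c N).automorphicQuotient} {c₁ : ℝ≥0} {μZ : Measure (borelQuotient F E c N)}
    (T : HX F E c N k μ →L[ℂ] HX F E c N k μ) {M : ℝ} (hT : ‖T‖ ≤ M) (ι : HX F E c N k μ →L[ℂ] HN F E c N k c₁ μZ) (α β : ℂ → HN F E c N k c₁ μZ) {z : ℂ} (hβ : β z ≠ 0)
    (hz : M < ‖∫ x, h x * (((borelHeight x : ℝ≥0) : ℝ) : ℂ) ^ z ∂μG‖) {ψ ψ' : HX F E c N k μ} {b b' : ℂ} (h₁ : T ψ = (∫ x, h x * (((borelHeight x : ℝ≥0) : ℝ) : ℂ) ^ z ∂μG) • ψ)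
    (h₂ : cnstN F E c N k c₁ μZ (ι ψ) = α z + b • β z) (h₁' : T ψ' = (∫ x, h x * (((borelHeight x : ℝ≥0) : ℝ) : ℂ) ^ z ∂μG) • ψ')
    (h₂' : cnstN F E c N k c₁ μZ (ι ψ') = α z + b' • β z) : ψ = ψ' ∧ b = b' :=
  pair_unique T ((cnstN F E c N k c₁ μZ).comp ι) hβ (hT.trans_lt hz) h₁ (by simpa only [ContinuousLinearMap.comp_apply] using h₂)
    h₁' (by simpa only [ContinuousLinearMap.comp_apply] using h₂')

/-- The uniqueness set `U₀ = {z : σ₁ < Re z ∧ M < |ĥ(z)|}` is open for `h ∈ C_c(G(𝔸_F))` and `μG` finite on compacta (`ĥ` is entire, ★ P5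
`differentiable_integral_mul_borelHeight_cpow`). [cite: BernsteinLapid2019, Thm 2.3] -/
theorem isOpen_blUniqueSet (μG : Measure (quasiSplit F E c N).Adelic) [IsFiniteMeasureOnCompacts μG]
    {h : (quasiSplit F E c N).Adelic → ℂ} (hh : Continuous h) (hhs : HasCompactSupport h) (σ₁ M : ℝ) :
    IsOpen {z : ℂ | σ₁ < z.re ∧ M < ‖∫ x, h x * (((borelHeight x : ℝ≥0) : ℝ) : ℂ) ^ z ∂μG‖} :=
  isOpen_setOf_lt_norm (differentiable_integral_mul_borelHeight_cpow μG hh hhs).continuous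
    (isOpen_lt continuous_const continuous_re) M

end E1

/-! ## §3 Non-emptiness: `ĥ(σ) → +∞` along the real axis when `h ≥ 0` charges `{H > 1}` -/

section Nonempty

variable {F E : Type} [Field F] [NumberField F] [Field E] [NumberField E] [Algebra F E] {c : E ≃ₐ[F] E}
variable {N : ℕ} [NeZero N]
variable [MeasurableSpace (quasiSplit F E c N).Adelic] [BorelSpace (quasiSplit F E c N).Adelic]

omit [BorelSpace (quasiSplit F E c N).Adelic] in
/-- For real `h` and real `σ`, `∫ h(x)·H(x)^σ` computed in `ℂ` is the real integral. [folklore] -/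
theorem integral_ofReal_mul_cpow_ofReal (μG : Measure (quasiSplit F E c N).Adelic) (h : (quasiSplit F E c N).Adelic → ℝ) (σ : ℝ) :
    (∫ x, (h x : ℂ) * (((borelHeight x : ℝ≥0) : ℝ) : ℂ) ^ (σ : ℂ) ∂μG) = ((∫ x, h x * ((borelHeight x : ℝ≥0) : ℝ) ^ σ ∂μG : ℝ) : ℂ) := by
  rw [← integral_complex_ofReal]
  refine integral_congr_ae (Eventually.of_forall fun x => ?_)
  simp only [ofReal_mul, ofReal_cpow (borelHeight_coe_pos x).le]

/-- **Lower bound** `∫ h·H^σ ≥ (h(g₀)∕2)·μG(O)·q^σ` (`σ ≥ 0`), `q = (1 + H(g₀))∕2`, `O = {h > h(g₀)∕2} ∩ {H > q}`, for `h ≥ 0` in `C_c`.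
[cite: BernsteinLapid2019, §4 Claim 1] -/
theorem integral_mul_borelHeight_rpow_ge (μG : Measure (quasiSplit F E c N).Adelic) [IsFiniteMeasureOnCompacts μG]
    {h : (quasiSplit F E c N).Adelic → ℝ} (hh : Continuous h) (hhs : HasCompactSupport h) (h0 : ∀ x, 0 ≤ h x) {g₀ : (quasiSplit F E c N).Adelic} {σ : ℝ} (hσ : 0 ≤ σ) :
    h g₀ / 2 * μG.real ({x | h g₀ / 2 < h x} ∩ {x | (1 + ((borelHeight g₀ : ℝ≥0) : ℝ)) / 2 < ((borelHeight x : ℝ≥0) : ℝ)}) * ((1 + ((borelHeight g₀ : ℝ≥0) : ℝ)) / 2) ^ σ ≤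
      ∫ x, h x * ((borelHeight x : ℝ≥0) : ℝ) ^ σ ∂μG := by
  set q : ℝ := (1 + ((borelHeight g₀ : ℝ≥0) : ℝ)) / 2 with hq
  set O : Set (quasiSplit F E c N).Adelic := {x | h g₀ / 2 < h x} ∩ {x | q < ((borelHeight x : ℝ≥0) : ℝ)} with hO
  have hOo : IsOpen O := (isOpen_lt continuous_const hh).inter (isOpen_lt continuous_const continuous_borelHeight_coe)
  have hq0 : 0 ≤ q := by rw [hq]; positivity
  have hOsub : O ⊆ tsupport h := fun x hx =>
    subset_tsupport _ (Function.mem_support.2 (lt_of_le_of_lt (by linarith [h0 g₀]) hx.1).ne')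
  have hOfin : μG O < ∞ := (measure_mono hOsub).trans_lt hhs.isCompact.measure_lt_top
  -- pointwise: `(h g₀/2 · q^σ)·𝟙_O ≤ h·H^σ`
  have hpt : ∀ x, O.indicator (fun _ => h g₀ / 2 * q ^ σ) x ≤ h x * ((borelHeight x : ℝ≥0) : ℝ) ^ σ := by
    intro x
    by_cases hx : x ∈ O
    · rw [indicator_of_mem hx]
      exact mul_le_mul hx.1.le (Real.rpow_le_rpow hq0 hx.2.le hσ) (Real.rpow_nonneg hq0 σ) (h0 x)
    · rw [indicator_of_notMem hx]
      exact mul_nonneg (h0 x) (Real.rpow_nonneg (borelHeight_coe_pos x).le σ)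
  have hint : Integrable (fun x => h x * ((borelHeight x : ℝ≥0) : ℝ) ^ σ) μG :=
    (hh.mul (continuous_borelHeight_coe.rpow_const fun x => Or.inl (borelHeight_coe_pos x).ne')).integrable_of_hasCompactSupport
      hhs.mul_right
  have hind : Integrable (O.indicator fun _ => h g₀ / 2 * q ^ σ) μG :=
    (integrableOn_const (hOfin.ne)).integrable_indicator hOo.measurableSet
  calc h g₀ / 2 * μG.real O * q ^ σ = ∫ x, O.indicator (fun _ => h g₀ / 2 * q ^ σ) x ∂μG := by
        rw [integral_indicator_const _ hOo.measurableSet, smul_eq_mul]; ring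
    _ ≤ ∫ x, h x * ((borelHeight x : ℝ≥0) : ℝ) ^ σ ∂μG := integral_mono hind hint hpt

/-- **`ĥ(σ) → +∞` along the real axis** when `h ≥ 0` (continuous, compact support) does not vanish at a point `g₀` with `H(g₀) > 1`
and `μG` is positive on non-empty open sets (Haar). [cite: BernsteinLapid2019, §4 Claim 1] -/
theorem tendsto_integral_mul_borelHeight_rpow_atTop (μG : Measure (quasiSplit F E c N).Adelic) [IsFiniteMeasureOnCompacts μG]
    [μG.IsOpenPosMeasure] {h : (quasiSplit F E c N).Adelic → ℝ} (hh : Continuous h) (hhs : HasCompactSupport h)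
    (h0 : ∀ x, 0 ≤ h x) {g₀ : (quasiSplit F E c N).Adelic} (hg₀ : h g₀ ≠ 0) (hH : 1 < borelHeight g₀) :
    Tendsto (fun σ : ℝ => ∫ x, h x * ((borelHeight x : ℝ≥0) : ℝ) ^ σ ∂μG) atTop atTop := by
  set q : ℝ := (1 + ((borelHeight g₀ : ℝ≥0) : ℝ)) / 2 with hq
  set O : Set (quasiSplit F E c N).Adelic := {x | h g₀ / 2 < h x} ∩ {x | q < ((borelHeight x : ℝ≥0) : ℝ)} with hO
  have hH' : (1 : ℝ) < ((borelHeight g₀ : ℝ≥0) : ℝ) := by exact_mod_cast hH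
  have hq1 : 1 < q := by rw [hq]; linarith
  have hpos0 : 0 < h g₀ := lt_of_le_of_ne (h0 g₀) (Ne.symm hg₀)
  have hOo : IsOpen O := (isOpen_lt continuous_const hh).inter (isOpen_lt continuous_const continuous_borelHeight_coe)
  have hg₀O : g₀ ∈ O := ⟨by show h g₀ / 2 < h g₀; linarith, by show q < _; rw [hq]; linarith⟩
  have hOpos : 0 < μG.real O :=
    ENNReal.toReal_pos (hOo.measure_ne_zero μG ⟨g₀, hg₀O⟩)
      ((measure_mono (show O ⊆ tsupport h from fun x hx =>
        subset_tsupport _ (Function.mem_support.2 (lt_of_le_of_lt (by linarith [h0 g₀]) hx.1).ne'))).trans_lt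
        hhs.isCompact.measure_lt_top).ne
  have hC : 0 < h g₀ / 2 * μG.real O := mul_pos (by linarith) hOpos
  refine tendsto_atTop_mono' atTop ?_ ((tendsto_rpow_atTop_of_base_gt_one q hq1).const_mul_atTop hC)
  filter_upwards [eventually_ge_atTop (0 : ℝ)] with σ hσ
  exact integral_mul_borelHeight_rpow_ge μG hh hhs h0 hσ

/-- **The uniqueness set meets every right half-plane**: `∀ σ₁ M, ∃ σ > σ₁` real with `M < |ĥ(σ)|`. [cite: BernsteinLapid2019, Thm 2.3] -/
theorem exists_gt_and_lt_norm_integral (μG : Measure (quasiSplit F E c N).Adelic) [IsFiniteMeasureOnCompacts μG]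
    [μG.IsOpenPosMeasure] {h : (quasiSplit F E c N).Adelic → ℝ} (hh : Continuous h) (hhs : HasCompactSupport h)
    (h0 : ∀ x, 0 ≤ h x) {g₀ : (quasiSplit F E c N).Adelic} (hg₀ : h g₀ ≠ 0) (hH : 1 < borelHeight g₀) (σ₁ M : ℝ) :
    ∃ σ : ℝ, σ₁ < σ ∧ M < ‖∫ x, (h x : ℂ) * (((borelHeight x : ℝ≥0) : ℝ) : ℂ) ^ (σ : ℂ) ∂μG‖ := by
  have ht := tendsto_integral_mul_borelHeight_rpow_atTop μG hh hhs h0 hg₀ hH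
  obtain ⟨σ, hσ⟩ := ((ht.eventually_gt_atTop M).and (eventually_gt_atTop σ₁)).exists
  exact ⟨σ, hσ.2, by rw [integral_ofReal_mul_cpow_ofReal, norm_real, Real.norm_eq_abs]; exact hσ.1.trans_le (le_abs_self _)⟩

/-- Hence `U₀ = {σ₁ < Re z ∧ M < |ĥ(z)|}` is non-empty. [cite: BernsteinLapid2019, Thm 2.3] -/
theorem blUniqueSet_nonempty (μG : Measure (quasiSplit F E c N).Adelic) [IsFiniteMeasureOnCompacts μG]
    [μG.IsOpenPosMeasure] {h : (quasiSplit F E c N).Adelic → ℝ} (hh : Continuous h) (hhs : HasCompactSupport h)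
    (h0 : ∀ x, 0 ≤ h x) {g₀ : (quasiSplit F E c N).Adelic} (hg₀ : h g₀ ≠ 0) (hH : 1 < borelHeight g₀) (σ₁ M : ℝ) :
    {z : ℂ | σ₁ < z.re ∧ M < ‖∫ x, (h x : ℂ) * (((borelHeight x : ℝ≥0) : ℝ) : ℂ) ^ z ∂μG‖}.Nonempty := by
  obtain ⟨σ, hσ, hM⟩ := exists_gt_and_lt_norm_integral μG hh hhs h0 hg₀ hH σ₁ M
  exact ⟨(σ : ℂ), by simpa only [mem_setOf_eq, ofReal_re] using And.intro hσ hM⟩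

end Nonempty

/-! ## §4 The good test function with `h(1) > 0`, and the closing corollary -/

section Good

variable {F E : Type} [Field F] [NumberField F] [Field E] [NumberField E] [Algebra F E] {c : E ≃ₐ[F] E}
variable {N : ℕ} [NeZero N]
variable [MeasurableSpace (quasiSplit F E c N).Adelic] [BorelSpace (quasiSplit F E c N).Adelic]

/-- ★ P5b's construction, re-run to export ALSO `h(1) > 0`: `h` continuous, compactly supported, `≥ 0`, bi-`K_U`-invariant, `h(1) > 0`,
`Re ĥ(z₀) > 0`. [cite: Langlands1976, §6 p. 167] [cite: BernsteinLapid2019, §4 Claim 1] -/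
theorem exists_biInvariant_one_pos_re_integral_pos (μ : Measure (quasiSplit F E c N).Adelic) [IsFiniteMeasureOnCompacts μ] [μ.IsOpenPosMeasure] (z₀ : ℂ) :
    ∃ h : (quasiSplit F E c N).Adelic → ℝ, Continuous h ∧ HasCompactSupport h ∧ (∀ x, 0 ≤ h x) ∧ (∀ k₁ k₂ : (quasiSplit F E c N).Adelic,
        adelicVal F E c N ((StdForm.antidiagonal N).over E) k₁ ∈ standardMaximalCompactGL N E →
        adelicVal F E c N ((StdForm.antidiagonal N).over E) k₂ ∈ standardMaximalCompactGL N E → ∀ x, h (k₁ * x * k₂) = h x) ∧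
      0 < h 1 ∧ 0 < (∫ x, (h x : ℂ) * (((borelHeight x : ℝ≥0) : ℝ) : ℂ) ^ z₀ ∂μ).re := by
  haveI := t2Space_quasiSplitAdelic (F := F) (E := E) (c := c) (N := N)
  haveI := locallyCompactSpace_quasiSplitAdelic (F := F) (E := E) (c := c) (N := N)
  haveI := secondCountableTopology_quasiSplitAdelic (F := F) (E := E) (c := c) (N := N)
  set K : Subgroup (quasiSplit F E c N).Adelic :=
    (standardMaximalCompactGL N E).comap (adelicVal F E c N ((StdForm.antidiagonal N).over E)) with hKdef
  have hKc : IsCompact (K : Set (quasiSplit F E c N).Adelic) := isCompact_comap_adelicVal_standardMaximalCompactGL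
  haveI : CompactSpace K := isCompact_iff_compactSpace.mp hKc
  let μK : Measure K := Measure.haar
  obtain ⟨U, hU, hKU⟩ := exists_nhds_forall_abs_mul_log_borelHeight_lt (F := F) (E := E) (c := c) (N := N) z₀
  obtain ⟨η, hη1, hη0, hηs, hη01⟩ := exists_continuous_one_zero_of_isCompact (isCompact_singleton (x := (1 : _)))
    (isOpen_interior (s := U)).isClosed_compl
    (disjoint_singleton_left.2 fun h1 => h1 (mem_interior_iff_mem_nhds.2 hU))
  have hηc : Continuous (η : (quasiSplit F E c N).Adelic → ℝ) := η.continuous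
  have hηnn : ∀ y, 0 ≤ η y := fun y => (hη01 y).1
  have hηU : ∀ y, η y ≠ 0 → y ∈ U := fun y hy => by
    by_contra hyU
    exact hy (hη0 (fun hy' => hyU (interior_subset hy')))
  set h : (quasiSplit F E c N).Adelic → ℝ :=
    fun x => ∫ p : K × K, η (((p.1 : K) : (quasiSplit F E c N).Adelic)⁻¹ * x * ((p.2 : K) : _)) ∂(μK.prod μK) with hh
  have hhc : Continuous h := continuous_doubleAverage K μK η hKc hηc
  have hhs : HasCompactSupport h := hasCompactSupport_doubleAverage K hKc μK hηs
  have hhnn : ∀ x, 0 ≤ h x := doubleAverage_nonneg K μK hηnn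
  have hh1 : 0 < h 1 := doubleAverage_one_pos K μK η hKc hηc hηnn (by rw [hη1 rfl]; exact one_ne_zero)
  refine ⟨h, hhc, hhs, hhnn, fun k₁ k₂ hk₁ hk₂ x =>
    doubleAverage_mul_mul K μK η (Subgroup.mem_comap.2 hk₁) (Subgroup.mem_comap.2 hk₂) x, hh1, ?_⟩
  have htube : ∀ x, h x ≠ 0 → |z₀.im * Real.log ((borelHeight x : ℝ≥0) : ℝ)| < 1 := by
    intro x hx
    obtain ⟨k₁, hk₁, k₂, hk₂, hne⟩ := exists_ne_zero_of_doubleAverage_ne_zero K μK η hx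
    have hy : k₁⁻¹ * x * k₂ ∈ U := hηU _ hne
    have hHx : borelHeight x = borelHeight (k₁ * (k₁⁻¹ * x * k₂)) := by
      rw [show k₁ * (k₁⁻¹ * x * k₂) = x * k₂ by simp only [mul_assoc, mul_inv_cancel_left],
        borelHeight_mul_of_mem_comap_standardMaximalCompactGL hk₂ x]
    rw [hHx]
    exact hKU k₁ (Subgroup.mem_comap.1 hk₁) _ hy
  set g : (quasiSplit F E c N).Adelic → ℝ := fun x =>
    h x * ((((borelHeight x : ℝ≥0) : ℝ) ^ z₀.re) * Real.cos (z₀.im * Real.log ((borelHeight x : ℝ≥0) : ℝ))) with hg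
  have hgc : Continuous g :=
    hhc.mul ((continuous_borelHeight_coe.rpow_const fun x => Or.inl (borelHeight_coe_pos x).ne').mul
      (Real.continuous_cos.comp (continuous_mul_log_borelHeight z₀)))
  have hgs : HasCompactSupport g := hhs.mul_right
  have hgnn : ∀ x, 0 ≤ g x := by
    intro x
    by_cases hx : h x = 0
    · simp only [hg, hx, zero_mul, le_refl]
    · exact mul_nonneg (hhnn x) (mul_nonneg (Real.rpow_nonneg (borelHeight_coe_pos x).le _)
        (cos_pos_of_abs_le_one (htube x hx).le).le)
  have hg1 : g 1 ≠ 0 := by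
    simp only [hg, borelHeight_one, NNReal.coe_one, Real.one_rpow, Real.log_one, mul_zero, Real.cos_zero, mul_one]
    exact hh1.ne'
  have hpos : 0 < ∫ x, g x ∂μ := hgc.integral_pos_of_hasCompactSupport_nonneg_nonzero hgs hgnn hg1
  have hint : Integrable (fun x => (h x : ℂ) * (((borelHeight x : ℝ≥0) : ℝ) : ℂ) ^ z₀) μ :=
    (continuous_mul_borelHeight_cpow (continuous_ofReal.comp hhc) z₀).integrable_of_hasCompactSupport
      ((hhs.comp_left ofReal_zero).mul_right)
  have hre : (∫ x, (h x : ℂ) * (((borelHeight x : ℝ≥0) : ℝ) : ℂ) ^ z₀ ∂μ).re = ∫ x, g x ∂μ := by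
    rw [← RCLike.re_to_complex, ← integral_re hint]
    refine integral_congr_ae (Eventually.of_forall fun x => ?_)
    simp only [RCLike.re_to_complex, re_ofReal_mul, re_ofReal_cpow_of_pos (borelHeight_coe_pos x), hg]
  rw [hre]
  exact hpos

omit [MeasurableSpace (quasiSplit F E c N).Adelic] [BorelSpace (quasiSplit F E c N).Adelic] in
/-- If `h` is continuous with `h(1) ≠ 0` and `1 ∈ closure {H > 1}`, some `g₀` has `h(g₀) ≠ 0` and `H(g₀) > 1`. [folklore] -/
theorem exists_ne_zero_one_lt_borelHeight {h : (quasiSplit F E c N).Adelic → ℝ} (hh : Continuous h) (hh1 : h 1 ≠ 0)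
    (h1 : (1 : (quasiSplit F E c N).Adelic) ∈ closure {g | 1 < borelHeight g}) : ∃ g₀ : (quasiSplit F E c N).Adelic, h g₀ ≠ 0 ∧ 1 < borelHeight g₀ := by
  have hO : IsOpen {g : (quasiSplit F E c N).Adelic | h g ≠ 0} := isOpen_ne_fun hh continuous_const
  exact mem_closure_iff.1 h1 _ hO hh1

omit [MeasurableSpace (quasiSplit F E c N).Adelic] [BorelSpace (quasiSplit F E c N).Adelic] in
/-- The set `{H > 1}` spelled with real coercions: `1 < H g ↔ 1 < (H g : ℝ)`. [folklore] -/
theorem one_lt_borelHeight_iff (g : (quasiSplit F E c N).Adelic) : 1 < borelHeight g ↔ (1 : ℝ) < ((borelHeight g : ℝ≥0) : ℝ) := by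
  rw [← NNReal.coe_lt_coe, NNReal.coe_one]

/-- **(BL-P6) CLOSING COROLLARY — the test function AND its uniqueness set** (any `N`, under `h1 : 1 ∈ closure {H > 1}`): for `μ` finite on
compacta and positive on opens and every `z₀` there is `h` continuous, compactly supported, `≥ 0`, bi-`K_U`-invariant, with `ĥ(z₀) ≠ 0` AND
`∀ σ₁ M, ∃ σ > σ₁` real with `M < |ĥ(σ)|` — so `U₀ = {σ₁ < Re z ∧ M < |ĥ(z)|}` (where `bl_pair_unique` applies, `‖δ(h)‖ ≤ M`) is NON-EMPTY
(★ P1a `hunq`). [cite: BernsteinLapid2019, Thm 2.3 and §4 Claims 1–2] -/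
theorem exists_testFunction_forall_exists_lt_norm (μ : Measure (quasiSplit F E c N).Adelic) [IsFiniteMeasureOnCompacts μ]
    [μ.IsOpenPosMeasure] (h1 : (1 : (quasiSplit F E c N).Adelic) ∈ closure {g | 1 < borelHeight g}) (z₀ : ℂ) :
    ∃ h : (quasiSplit F E c N).Adelic → ℝ, Continuous h ∧ HasCompactSupport h ∧ (∀ x, 0 ≤ h x) ∧ (∀ k₁ k₂ : (quasiSplit F E c N).Adelic,
        adelicVal F E c N ((StdForm.antidiagonal N).over E) k₁ ∈ standardMaximalCompactGL N E →
        adelicVal F E c N ((StdForm.antidiagonal N).over E) k₂ ∈ standardMaximalCompactGL N E → ∀ x, h (k₁ * x * k₂) = h x) ∧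
      (∫ x, (h x : ℂ) * (((borelHeight x : ℝ≥0) : ℝ) : ℂ) ^ z₀ ∂μ) ≠ 0 ∧ ∀ σ₁ M : ℝ, ∃ σ : ℝ, σ₁ < σ ∧ M < ‖∫ x, (h x : ℂ) * (((borelHeight x : ℝ≥0) : ℝ) : ℂ) ^ (σ : ℂ) ∂μ‖ := by
  obtain ⟨h, hc, hs, hnn, hK, hh1, hre⟩ := exists_biInvariant_one_pos_re_integral_pos (F := F) (E := E) (c := c) (N := N) μ z₀
  obtain ⟨g₀, hg₀, hH⟩ := exists_ne_zero_one_lt_borelHeight hc hh1.ne' h1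
  exact ⟨h, hc, hs, hnn, hK, fun h0 => hre.ne' (by rw [h0, zero_re]),
    fun σ₁ M => exists_gt_and_lt_norm_integral μ hc hs hnn hg₀ hH σ₁ M⟩

end Good

/-! ## §5 Discharge of `1 ∈ closure {H > 1}` at `N = 2` (the archimedean torus ray) and the hypothesis-free corollary -/

section RayTwo

variable {F E : Type} [Field F] [NumberField F] [Field E] [NumberField E] [Algebra F E] {c : E ≃ₐ[F] E}

/-- **`1 ∈ closure {H > 1}` on `U(J₂)(𝔸_F)`** (`c² = 1`): `t_s = d(z_E(e^s), z_E(e^s)⁻¹)` (★ BL-R1 `exists_torus_posRealIdele_two`) has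
`H(t_s) = e^{s[E:ℚ]} > 1` for `s > 0` and `t_s → 1` as `s → 0⁺` (closed embedding `G(𝔸_F) ↪ GL₂(𝔸_E)`). [cite: BernsteinLapid2019, §4 Claim 2 (p. 9)] -/
theorem one_mem_closure_setOf_one_lt_borelHeight_two (hc : c * c = 1) : (1 : (quasiSplit F E c 2).Adelic) ∈ closure {g : (quasiSplit F E c 2).Adelic | 1 < borelHeight g} := by
  classical
  choose t ht using fun r : ℝ≥0ˣ => exists_torus_posRealIdele_two (F := F) (E := E) (c := c) hc r
  set f : ℝ → (quasiSplit F E c 2).Adelic := fun s =>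
    ((t (expUnitNNReal s) : borelAdelic F E c 2) : (quasiSplit F E c 2).Adelic) with hf
  have hCE : Topology.IsClosedEmbedding ⇑(adelicVal F E c 2 ((StdForm.antidiagonal 2).over E)) :=
    (isClosed_adelic F E c 2 ((StdForm.antidiagonal 2).over E)).isClosedEmbedding_subtypeVal
  have hval : ∀ s, adelicVal F E c 2 ((StdForm.antidiagonal 2).over E) (f s) =
      glDiagonal 2 (AdeleRing (𝓞 E) E) ![posRealIdele E (expUnitNNReal s), (posRealIdele E (expUnitNNReal s))⁻¹] :=
    fun s => (ht _).1
  have hfc : Continuous f := by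
    rw [hCE.isInducing.continuous_iff]
    exact (DoubledUnitary.RankOneReduction.continuous_diag_posRealIdele_exp (E := E)).congr fun s => by simp only [Function.comp_apply, hval]
  have hone : (![(1 : (AdeleRing (𝓞 E) E)ˣ), 1] : Fin 2 → (AdeleRing (𝓞 E) E)ˣ) = 1 := by funext i; fin_cases i <;> rfl
  have hf0 : f 0 = 1 := hCE.injective (by rw [hval, map_one, expUnitNNReal_zero, map_one, inv_one, hone, map_one])
  have htend : Tendsto f (𝓝[>] (0 : ℝ)) (𝓝 1) := by rw [← hf0]; exact (hfc.tendsto 0).mono_left nhdsWithin_le_nhds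
  refine mem_closure_of_tendsto htend (eventually_nhdsWithin_of_forall fun s hs => ?_)
  have hH := (ht (expUnitNNReal s)).2.2 1
  rw [mul_one, borelHeight_one, mul_one] at hH
  show 1 < borelHeight (f s)
  rw [hH]
  refine one_lt_pow₀ ?_ Module.finrank_pos.ne'
  have h1 : (1 : ℝ) < (((expUnitNNReal s : ℝ≥0ˣ) : ℝ≥0) : ℝ) := by rw [coe_expUnitNNReal]; exact Real.one_lt_exp_iff.2 hs
  exact_mod_cast h1

variable [MeasurableSpace (quasiSplit F E c 2).Adelic] [BorelSpace (quasiSplit F E c 2).Adelic]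

/-- **(BL-P6) at `N = 2`, hypothesis-free** (`c² = 1`): for `μ` finite on compacta and positive on opens (Haar) and every `z₀` there is a
continuous, compactly supported, non-negative, bi-`K_U`-invariant `h` with `ĥ(z₀) ≠ 0` and `∀ σ₁ M, ∃ σ > σ₁` real, `M < |ĥ(σ)|`.
[cite: BernsteinLapid2019, Thm 2.3 and §4 Claims 1–2] -/
theorem exists_testFunction_forall_exists_lt_norm_two (hc : c * c = 1) (μ : Measure (quasiSplit F E c 2).Adelic) [IsFiniteMeasureOnCompacts μ] [μ.IsOpenPosMeasure] (z₀ : ℂ) :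
    ∃ h : (quasiSplit F E c 2).Adelic → ℝ, Continuous h ∧ HasCompactSupport h ∧ (∀ x, 0 ≤ h x) ∧ (∀ k₁ k₂ : (quasiSplit F E c 2).Adelic,
        adelicVal F E c 2 ((StdForm.antidiagonal 2).over E) k₁ ∈ standardMaximalCompactGL 2 E →
        adelicVal F E c 2 ((StdForm.antidiagonal 2).over E) k₂ ∈ standardMaximalCompactGL 2 E → ∀ x, h (k₁ * x * k₂) = h x) ∧
      (∫ x, (h x : ℂ) * (((borelHeight x : ℝ≥0) : ℝ) : ℂ) ^ z₀ ∂μ) ≠ 0 ∧ ∀ σ₁ M : ℝ, ∃ σ : ℝ, σ₁ < σ ∧ M < ‖∫ x, (h x : ℂ) * (((borelHeight x : ℝ≥0) : ℝ) : ℂ) ^ (σ : ℂ) ∂μ‖ :=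
  exists_testFunction_forall_exists_lt_norm μ (one_mem_closure_setOf_one_lt_borelHeight_two hc) z₀

/-- The CM packaging (`F = L⁺`, `E = L`, `c` = complex conjugation, `c² = 1` automatic): the same, hypothesis-free.
[cite: BernsteinLapid2019, Thm 2.3 and §4 Claims 1–2] -/
theorem exists_testFunction_forall_exists_lt_norm_cm_two (L : Type) [Field L] [NumberField L] [IsCMField L]
    [MeasurableSpace (quasiSplit (↥(maximalRealSubfield L)) L (IsCMField.complexConj L) 2).Adelic]
    [BorelSpace (quasiSplit (↥(maximalRealSubfield L)) L (IsCMField.complexConj L) 2).Adelic]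
    (μ : Measure (quasiSplit (↥(maximalRealSubfield L)) L (IsCMField.complexConj L) 2).Adelic) [IsFiniteMeasureOnCompacts μ] [μ.IsOpenPosMeasure] (z₀ : ℂ) :
    ∃ h : (quasiSplit (↥(maximalRealSubfield L)) L (IsCMField.complexConj L) 2).Adelic → ℝ, Continuous h ∧ HasCompactSupport h ∧ (∀ x, 0 ≤ h x) ∧
      (∀ k₁ k₂ : (quasiSplit (↥(maximalRealSubfield L)) L (IsCMField.complexConj L) 2).Adelic,
        adelicVal (↥(maximalRealSubfield L)) L (IsCMField.complexConj L) 2 ((StdForm.antidiagonal 2).over L) k₁ ∈ standardMaximalCompactGL 2 L →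
        adelicVal (↥(maximalRealSubfield L)) L (IsCMField.complexConj L) 2 ((StdForm.antidiagonal 2).over L) k₂ ∈ standardMaximalCompactGL 2 L → ∀ x, h (k₁ * x * k₂) = h x) ∧
      (∫ x, (h x : ℂ) * (((borelHeight x : ℝ≥0) : ℝ) : ℂ) ^ z₀ ∂μ) ≠ 0 ∧ ∀ σ₁ M : ℝ, ∃ σ : ℝ, σ₁ < σ ∧ M < ‖∫ x, (h x : ℂ) * (((borelHeight x : ℝ≥0) : ℝ) : ℂ) ^ (σ : ℂ) ∂μ‖ :=
  exists_testFunction_forall_exists_lt_norm_two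
    (AlgEquiv.ext fun x => IsCMField.complexConj_apply_apply L x) μ z₀

end RayTwo

end Summit.HodgeConjecture.HodgeConjecture.Cruxes.H413.K2E1BLUniquenessU2

end
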